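import Summits.QuantumFields.YangMills.Theorems.BalabanUVNodesN15TwoSpacingGluingCurvedKnitCovariantLandau
import HarnessLib

/-!
# THE GLUING STEP AT TWO LATTICE SPACINGS — PROGRAMME (P-R), VII: FILE 120 FOR BAŁABAN's FULLY COVARIANT SUMMAND `P(U) = a·Q*(U)Q(U) − D_U(I − R(U))D*_U` IN PER-CUBE
# GAUGES — the glued inverse of the model `Δ_a(U) = Δ_{R_U} + P(U)` with the cube gauges `u_k` LIVE, the conjugation row `hP` DISCHARGED, the species and perturbation letters of
# the cubes' own gauges displayed (dag-n15-c g22, n15-c∕202; N15 = NE2, s1)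

Cell `pub-ymgap`, seat `pub-ymgap-dag-n15-c` (R134 (a); HUMAN RULING D-0062), generation 22.  `bears_on: R4∕N15 · K3⁸ SpineGivenEndpointR13SepCoPHV (stmt-QuantumFields-27366)`.
Filed `--supports stmt-QuantumFields-27366 --as helper` — COUNT-NEUTRAL.  One theorem, no `def`, 0 `sorry`; NO new estimate (an INSTANTIATION of FILE 120).  Imports BY NAME n15-c∕201
`…CurvedKnitCovariantLandau` (`cvNVr`, `cvGauge`, ★★★ `cv_hP_live`; through it 183 `cvNVq`, FILE 119∕120 `cvGlued`∕`uN_cvGlued_spec`∕`cvNL`∕`cvChi`∕`cvPsi`∕`CvNorm`).  Nothing in the tree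
modified ∕ restated.

WHY (HOME HANDOFF g11 (Γ15) «background-LIVE glued family in cube gauges (the honest NE2⁺ architecture)», g16 «THE FINDING», g21∕g22 PROGRAMMES (P-Q)∕(P-R)).  FILE 120 `uN_cvGlued_spec` is
the live-`U` knit at the cover for ARBITRARY unitary per-cube gauges `u_k`, an arbitrary summand `P` and perturbations `N_V k`, under four kinds of rows: the conjugation row `hP`, the
species letters `tCoefC`∕`tCoefA` of `Δ_{R_{U^{u_k}}}` on the cut boxes, and the near ∕ far letters of `N_V k`.  Every instantiation so far (FILES 125–196) took `u ≡ 1` because `hP`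
was out of reach for a non-covariant `P`.  With Bałaban's summand now fully covariant in the model ([Balaban1985BackgroundPropagators] (3.26) p. 395: `Δ_a(U) = Δ(U) + D_U R(U) D*_U +
Q*(U)aQ(U)`; here `P(U) = N_L ⊗ 1 − N_V^Q(U) − N_V^R(U) = a·Q*(U)Q(U) − D_U(I − R(U))D*_U`, n15-c∕201 `cvNL_sub_cvNVq_sub_cvNVr`) and `hP` PROVED for live `u_k` (n15-c∕201 `cv_hP_live`,
from (3.31)–(3.34) in the model), THIS FILE is FILE 120 with the cube gauges LIVE: the perturbation of cube `k` is `N_V k := (N_V^Q + N_V^R)(U^{u_k})` — READ IN THE CUBE's OWN GAUGE,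
where (3.35) puts `U^{u_k} = e^{iηA_k}` with `A_k` small on `□̃_k` — and the remaining rows are exactly Bałaban's per-cube inputs: the (3.35)∕(3.51)–(3.54) species letters of
`Δ_{R_{U^{u_k}}}` on the cut box and the near∕far letters of `(N_V^Q + N_V^R)(U^{u_k})` ((3.59)–(3.60) for the averaging words; Thms 3.2–3.3 ∕ (3.49) for `D(I−R)D*`), DISPLAYED.

WHAT.  ★★★ **`cvP_cvGlued_spec`** — `uN_cvGlued_spec` with `u k := u₀ k ∘ pr₁` (unitary SITE gauges lifted to the bond points), `P := N_L ⊗ 1 − N_V^Q(U) − N_V^R(U)`,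
`N_V k := N_V^Q(U^{u₀ k}) + N_V^R(U^{u₀ k})`, the row `hP` discharged by `cv_hP_live`: `∃ δ w₀ R₀ θ₀ B > 0`, for every cover index, trace-form-orthonormal `e`, unitary site gauges `u₀ k`,
EVERY bond field `U`, letters `r_V, R_N, θ_F` with `r_V(1+|J⊕J|) + R_N ≤ R₀`, `θ_F ≤ θ₀`, the displayed species rows in the gauges `u₀ k` and the displayed near∕far rows of `N_V k`:
the glued operator is `≤ B·e^{−(δ∕16)d}` blockwise AND the two-sided inverse of `Δ_{R_U} + P(U)`.

HONEST FRAMING ∕ LIMITS.  An instantiation; the displayed rows are NOT produced here: the species rows need the per-cube (3.35) letters of `U^{u₀ k}` on `□̃_k` (n15-w2's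
`uN_localCoefLetters_of_gauge335` gives them from `U^{u₀ k} = e^{iηA_k}` with `‖A_k‖ < C∕ξ`, `‖η⁻¹∇^ηA_k‖ < C∕ξ²` on the cut box — the sequel), the `N_V^Q` rows need the transporter
smallness there (n15-c∕182b `hasMaj_nvQ`), and the `N_V^R` rows ARE the content of [Balaban1985BackgroundPropagators] Thms 3.2–3.3 ∕ (3.49) in the model (random-walk expansion of
`G′(U)`, `R(U)` — NOT in the tree; the located next object).  MODEL as FILES 119∕181∕197 (doubled-torus cover, one averaging level, uniform weights in `Δ′_a`, one-level staircases,
`Q(U)` = main term (125), component-blind site gauges).  NOT [Balaban1985BackgroundPropagators] Thm 3.1∕3.3 as printed; NE2⁺ NOT PRINTED; N15 of record untouched (DISCHARGED AS CONSUMED,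
p687738); counts UNMOVED (typed 28∕28); one finite 𝕋⁴ at fixed ε per index — NOT infinite volume ∕ OS ∕ mass gap ∕ Clay.  Restate-immune (no Theses import).
-/

noncomputable section

open scoped BigOperators Matrix Matrix.Norms.Frobenius

namespace Summit.QuantumFields.YangMills.BalabanUVNodes.N15.Gluing

open Real
open Literature.MathematicalPhysics.QuantumFieldTheory.Balaban1983to89
open Literature.MathematicalPhysics.QuantumFieldTheory.Balaban1983to89.B5Prop11Plancherel (Tor fine unitVec)
open Literature.MathematicalPhysics.QuantumFieldTheory.Balaban1983to89.B11SectG (BlockNorm HasMaj)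
open Literature.MathematicalPhysics.QuantumFieldTheory.Balaban1983to89.B6Prop26Gluing (mulOp mulOp_apply)
open Literature.MathematicalPhysics.QuantumFieldTheory.Balaban1983to89.B6UnitTorusCarrier (unitTorusGeo)
open Literature.Barriers.QuantumFields (traceForm)
open Summit.QuantumFields.YangMills.BalabanUVNodes.N15.BackgroundLayer (covLapM tCoefA tCoefC)
open Summit.QuantumFields.YangMills.BalabanUVNodes.N15.VectorPiece (bshiftEquiv)
open Summit.QuantumFields.YangMills.BalabanUVNodes.N15.MatrixSpecies (mmulOp coordMat)
open Summit.QuantumFields.YangMills.BalabanUVNodes.N15.CurvedSpecies (gaugePair)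

variable {d : ℕ} {L : ℕ} [NeZero L]

/-- ★★★ **FILE 120 FOR BAŁABAN's FULLY COVARIANT SUMMAND IN PER-CUBE GAUGES** (`uN_cvGlued_spec` with `u k := u₀ k ∘ pr₁`, `P := N_L ⊗ 1 − N_V^Q(U) − N_V^R(U) = a·Q*(U)Q(U) −
D_U(I−R(U))D*_U`, `N_V k := (N_V^Q + N_V^R)(U^{u₀ k})`, the conjugation row `hP` DISCHARGED by n15-c∕201 `cv_hP_live`): for odd `L ≥ 7`, `a > 0`, a colour index `ι` there are
`δ, w₀, R₀, θ₀, B > 0` such that on every doubled torus of the cover (`k ≥ 1`, `L^m ≥ w₀`), for trace-form coordinates `e`, unitary site gauges `u₀ k`, EVERY bond field `U` and letters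
`r_V, R_N, θ_F ≥ 0` with `r_V(1 + |J ⊕ J|) + R_N ≤ R₀`, `θ_F ≤ θ₀`: IF the species letters of `Δ_{R_{U^{u₀ k}}}` on the cut boxes are `≤ r_V` and the perturbation `(N_V^Q + N_V^R)(U^{u₀ k})`
is `≤ R_N e^{−δd}` between the plateau and the cut box and `≤ θ_F e^{−δd}` off the plateau, THEN the glued operator of the dressed smooth-cut cubes in the gauges `u₀ k` is
`≤ B·e^{−(δ∕16)d}` blockwise AND the two-sided inverse of `Δ_{R_U} + a·Q*(U)Q(U) − D_U(I−R(U))D*_U`.  MODEL; NOT [B9] Thm 3.1∕3.3 as printed.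
[cite: Balaban1985BackgroundPropagators, Thm 3.1 p.397 and Thm 3.3 p.399 (shape: «G(U) … for U satisfying (3.35)»), (3.26) p.395, (3.31)–(3.35) pp.395–396, (3.49) p.399, (3.50)–(3.54) pp.400–401, (3.59)–(3.65) pp.402–403, (3.76)–(3.77) p.406; Balaban1984PropagatorsII, (2.91)–(2.93) p.239] -/
theorem cvP_cvGlued_spec (hL : Odd L ∧ 1 < L) (hL7 : 7 ≤ L) {a : ℝ} (ha : 0 < a) (ι : Type) [Fintype ι] [DecidableEq ι] :
    ∃ δ w₀ R₀ θ₀ B : ℝ, 0 < δ ∧ 0 < R₀ ∧ 0 < θ₀ ∧ 0 < B ∧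
      ∀ (mv kk : ℕ), 1 ≤ kk → w₀ ≤ ((L ^ mv : ℕ) : ℝ) →
      ∀ {mm : Type} [Fintype mm] [DecidableEq mm] (e : Matrix mm mm ℂ ≃L[ℝ] (ι → ℝ)), (∀ A B : Matrix mm mm ℂ, traceForm A B = e A ⬝ᵥ e B) →
      ∀ (u₀ : (Fin (d + 1) → ZMod (2 * L)) → Tor (fine (L ^ kk) (cvM d L mv kk hL)) → Matrix mm mm ℂ), (∀ k x, (u₀ k x)ᴴ * u₀ k x = 1) →
      ∀ (U : Fin (d + 1) → CvX d L mv kk hL → Matrix mm mm ℂ) (rV RN θF : ℝ),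
        0 ≤ rV → 0 ≤ RN → 0 ≤ θF → rV * (1 + Fintype.card (Fin (d + 1) ⊕ Fin (d + 1))) + RN ≤ R₀ → θF ≤ θ₀ →
        (∀ k x, cvChi d L mv kk hL k x ≠ 0 → ∀ i, ∑ j, |tCoefC ((((L ^ kk : ℕ) : ℝ))⁻¹) (gaugePair (bshiftEquiv (cvM d L mv kk hL) (L ^ kk)) fun μ x => coordMat e (ContinuousLinearMap.mulLeftRight ℝ (Matrix mm mm ℂ) (u₀ k x.1 * U μ x * (u₀ k (bshiftEquiv (cvM d L mv kk hL) (L ^ kk) μ x).1)ᴴ) (u₀ k x.1 * U μ x * (u₀ k (bshiftEquiv (cvM d L mv kk hL) (L ^ kk) μ x).1)ᴴ)ᴴ)) x i j| ≤ rV) →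
        (∀ k j' x, cvChi d L mv kk hL k x ≠ 0 → ∀ i, ∑ j, |tCoefA ((((L ^ kk : ℕ) : ℝ))⁻¹) (gaugePair (bshiftEquiv (cvM d L mv kk hL) (L ^ kk)) fun μ x => coordMat e (ContinuousLinearMap.mulLeftRight ℝ (Matrix mm mm ℂ) (u₀ k x.1 * U μ x * (u₀ k (bshiftEquiv (cvM d L mv kk hL) (L ^ kk) μ x).1)ᴴ) (u₀ k x.1 * U μ x * (u₀ k (bshiftEquiv (cvM d L mv kk hL) (L ^ kk) μ x).1)ᴴ)ᴴ)) j' x i j| ≤ rV) →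
        (∀ k, HasMaj (CvNorm d L mv kk hL ι) (CvNorm d L mv kk hL ι) (mulOp (fun p : CvX d L mv kk hL × ι => cvPsi d L mv kk hL k p.1) ∘ₗ (cvNVq d L mv kk hL a ι e (cvGauge d L mv kk hL (fun p => u₀ k p.1) U) + cvNVr d L mv kk hL a ι e (cvGauge d L mv kk hL (fun p => u₀ k p.1) U)) ∘ₗ mulOp (fun p : CvX d L mv kk hL × ι => cvChi d L mv kk hL k p.1)) (fun y y' => RN * Real.exp (-(δ * (unitTorusGeo L kk (cvM d L mv kk hL)).dist y y')))) →
        (∀ k, HasMaj (CvNorm d L mv kk hL ι) (CvNorm d L mv kk hL ι) ((LinearMap.id - mulOp (fun p : CvX d L mv kk hL × ι => cvPsi d L mv kk hL k p.1)) ∘ₗ (cvNVq d L mv kk hL a ι e (cvGauge d L mv kk hL (fun p => u₀ k p.1) U) + cvNVr d L mv kk hL a ι e (cvGauge d L mv kk hL (fun p => u₀ k p.1) U)) ∘ₗ mulOp (fun p : CvX d L mv kk hL × ι => cvChi d L mv kk hL k p.1)) (fun y y' => θF * Real.exp (-(δ * (unitTorusGeo L kk (cvM d L mv kk hL)).dist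 y y')))) →
        HasMaj (CvNorm d L mv kk hL ι) (CvNorm d L mv kk hL ι) (cvGlued d L mv kk hL a ((((L ^ kk : ℕ) : ℝ))⁻¹) ι e (fun k (p : CvX d L mv kk hL) => u₀ k p.1) U (cvNL d L mv kk hL a ι - cvNVq d L mv kk hL a ι e U - cvNVr d L mv kk hL a ι e U) (fun k => (cvNVq d L mv kk hL a ι e (cvGauge d L mv kk hL (fun p => u₀ k p.1) U) + cvNVr d L mv kk hL a ι e (cvGauge d L mv kk hL (fun p => u₀ k p.1) U))))
          (fun y y' => B * Real.exp (-(δ / 16 * (unitTorusGeo L kk (cvM d L mv kk hL)).dist y y'))) ∧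
        (cvGlued d L mv kk hL a ((((L ^ kk : ℕ) : ℝ))⁻¹) ι e (fun k (p : CvX d L mv kk hL) => u₀ k p.1) U (cvNL d L mv kk hL a ι - cvNVq d L mv kk hL a ι e U - cvNVr d L mv kk hL a ι e U) (fun k => (cvNVq d L mv kk hL a ι e (cvGauge d L mv kk hL (fun p => u₀ k p.1) U) + cvNVr d L mv kk hL a ι e (cvGauge d L mv kk hL (fun p => u₀ k p.1) U))) ∘ₗ (covLapM (bshiftEquiv (cvM d L mv kk hL) (L ^ kk)) ((((L ^ kk : ℕ) : ℝ))⁻¹) (gaugePair (bshiftEquiv (cvM d L mv kk hL) (L ^ kk)) (fun μ x => coordMat e (ContinuousLinearMap.mulLeftRight ℝ (Matrix mm mm ℂ) (U μ x) (U μ x)ᴴ))) + (cvNL d L mv kk hL a ι - cvNVq d L mv kk hL a ι e U - cvNVr d L mv kk hL a ι e U)) = LinearMap.id ∧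
          (covLapM (bshiftEquiv (cvM d L mv kk hL) (L ^ kk)) ((((L ^ kk : ℕ) : ℝ))⁻¹) (gaugePair (bshiftEquiv (cvM d L mv kk hL) (L ^ kk)) (fun μ x => coordMat e (ContinuousLinearMap.mulLeftRight ℝ (Matrix mm mm ℂ) (U μ x) (U μ x)ᴴ))) + (cvNL d L mv kk hL a ι - cvNVq d L mv kk hL a ι e U - cvNVr d L mv kk hL a ι e U)) ∘ₗ cvGlued d L mv kk hL a ((((L ^ kk : ℕ) : ℝ))⁻¹) ι e (fun k (p : CvX d L mv kk hL) => u₀ k p.1) U (cvNL d L mv kk hL a ι - cvNVq d L mv kk hL a ι e U - cvNVr d L mv kk hL a ι e U) (fun k => (cvNVq d L mv kk hL a ι e (cvGauge d L mv kk hL (fun p => u₀ k p.1) U) + cvNVr d L mv kk hL a ι e (cvGauge d L mv kk hL (fun p => u₀ k p.1) U))) = LinearMap.id)  := by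
  obtain ⟨δ, w₀, R₀, θ₀, B, hδ, hR₀, hθ₀, hB, H⟩ := uN_cvGlued_spec (d := d) hL hL7 ha ι
  refine ⟨δ, w₀, R₀, θ₀, B, hδ, hR₀, hθ₀, hB, fun mv kk hk hw₀ => ?_⟩
  intro mm _ _ e he u₀ hu U rV RN θF hrV hRN hθF hRle hθle hC hA hNVcut hfarN
  exact H mv kk hk hw₀ e he (fun k (p : CvX d L mv kk hL) => u₀ k p.1) (fun k p => hu k p.1) U
    (cvNL d L mv kk hL a ι - cvNVq d L mv kk hL a ι e U - cvNVr d L mv kk hL a ι e U)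
    (fun k => cvNVq d L mv kk hL a ι e (cvGauge d L mv kk hL (fun p => u₀ k p.1) U) + cvNVr d L mv kk hL a ι e (cvGauge d L mv kk hL (fun p => u₀ k p.1) U))
    rV RN θF hrV hRN hθF hRle hθle (fun k => cv_hP_live mv kk hL a e he hu U k) hC hA hNVcut hfarN

end Summit.QuantumFields.YangMills.BalabanUVNodes.N15.Gluing

end
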